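import Mathlib.Analysis.Calculus.ParametricIntervalIntegral
import Mathlib.Analysis.Calculus.ContDiff.FiniteDimension
import Mathlib.Analysis.Calculus.FDeriv.Extend
import Mathlib.Analysis.InnerProductSpace.Calculus
import Mathlib.MeasureTheory.Integral.DominatedConvergence
import Mathlib.MeasureTheory.Integral.IntervalIntegral.Basic
import Literature.Analysis.FluidPDE.ClassicalSolution
import HarnessLib

/-!
# Smooth dependence on parameters of interval integrals, up to the boundary of the time set

Analysis/FluidPDE support file. `Literature.Analysis.FunctionSpaces.SmoothParametricIntegral`
differentiates `p ↦ ∫ σ in a..b, H (σ, p)` under the integral sign for integrands `H` smooth on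
all of `ℝ × P`, and `PressureReconstruction` deduces the joint smoothness of the segment (Poincaré)
potential `(t, x) ↦ ∫₀¹ ⟪G(t, σx), x⟫ dσ` of a field `G` jointly smooth on `S × E` for **open**
time sets `S` (localising with a bump in time). Classical solutions of the tree
(`Literature.Analysis.FluidPDE.IsClassicalNSSolutionOn`, `IsSmoothSpaceTimeOn S`) live on
*intervals* `S = [0, T)`, `[0, T]`, `[0, ∞)`, where joint smoothness is the within-set notion
`ContDiffOn ℝ ∞ (uncurry w) (S ×ˢ univ)` including the endpoints. This file supplies the
endpoint case:

* `hasFDerivWithinAt_parametric_intervalIntegral_prod`: for `S ⊆ ℝ` convex with non-empty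
  interior and `H` of class `C¹` within `univ ×ˢ (S ×ˢ univ)`, the parametric integral
  `p ↦ ∫ σ in a..b, H (σ, p)` has, within `S ×ˢ univ` at every point, the derivative
  `∫ σ in a..b, D H (σ, p) ∘ (0, ·)` (the within-derivative of `H`). At interior times this is the
  usual Leibniz rule (`hasFDerivAt_parametric_intervalIntegral_of_mem_nhds`, dominated
  differentiation with the bound coming from continuity of the derivative); at an endpoint `t₀ ∈ S`
  it is obtained from the interior by Mathlib's `hasFDerivWithinAt_closure_of_tendsto_fderiv`
  (a function differentiable on an open convex set, continuous on its closure, whose derivative has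
  a limit at a boundary point, is differentiable within the closure there), applied on the one-sided
  slab `(t₀, t₀ + r) × X` (resp. `(t₀ − r, t₀) × X`).
* `contDiffOn_parametric_intervalIntegral_prod`: if `H` is `C^∞` within `univ ×ˢ (S ×ˢ univ)` then
  the parametric integral is `C^∞` within `S ×ˢ univ` (induction on the order through Mathlib's
  `contDiffOn_succ_iff_fderiv_apply`, as in the open case).
* `IsSmoothSpaceTimeOn.segmentIntegral_of_convex`: the segment potential of a field jointly smooth
  on `S × E`, `S` a convex time set of unique differentiability (= a non-degenerate interval), is
  jointly smooth on `S × E` — the endpoint-inclusive version of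
  `IsSmoothSpaceTimeOn.segmentIntegral`, used to reconstruct the pressure of a vorticity solution
  on `[0, T)` (`NSVorticityProofs`).

## Why convexity of the time set

The statement is false for general time sets of unique differentiability, even for
`S ⊆ closure (interior S)`: on `S = (−1, 0] ∪ ⋃ₙ [hₙ, hₙ + hₙ²]` (`hₙ ↓ 0`) there are fields `G`,
`C^∞` within `S × ℝ³`, whose difference quotients `(G(hₙ, ·) − G(0, ·))/hₙ` converge pointwise but
not locally uniformly, and whose segment potential has no time derivative within `S` at `t = 0`
(no mean-value theorem in time across the gaps of `S`); see the module docstring of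
`NSVorticityProofs` for the resulting counterexample to the vorticity/velocity equivalence. On an
interval every point has one-sided interval neighbourhoods inside `S`, which is exactly what the
closure argument uses (`exists_Ioo_Icc_mem_nhdsWithin_of_convex`).

## Mathlib search

Mathlib (this pin) has `intervalIntegral.hasFDerivAt_integral_of_dominated_of_fderiv_le` (one
derivative under the integral sign, at interior points), `intervalIntegral.continuousWithinAt_of_dominated_interval`,
`hasFDerivWithinAt_closure_of_tendsto_fderiv`, `IsCompact.eventually_forall_of_forall_eventually`
(tube lemma), `contDiffOn_succ_iff_fderiv_apply`, `uniqueDiffOn_convex`; no within-set (`ContDiffOn`)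
statement for parametric integrals (searched `ContDiffOn` + `integral`, `parametric`: none).

## References

* L. C. Evans, *Partial Differential Equations*, 2nd ed. (2010), App. C (differentiation under the
  integral sign).
* L. Hörmander, *The Analysis of Linear Partial Differential Operators I*, 2nd ed. (1990),
  Thm. 1.1.7–1.1.9.
-/

noncomputable section

open MeasureTheory Set Filter Metric intervalIntegral Function
open _root_.Topology
open scoped ContDiff RealInnerProductSpace

namespace Literature.Analysis.FluidPDE

/-! ### Parametric integrals of integrands continuous / smooth within `univ ×ˢ D` -/

section General

variable {P : Type*} [NormedAddCommGroup P] [NormedSpace ℝ P]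
variable {F : Type*} [NormedAddCommGroup F] [NormedSpace ℝ F]

omit [NormedSpace ℝ P] [NormedSpace ℝ F] in
/-- **Local uniform bound** (tube lemma). If `H` is continuous within `univ ×ˢ D` then near any
`p₀ ∈ D`, within `D`, `‖H (σ, p)‖` is bounded uniformly for `σ` in the compact interval
`uIcc a b` (Mathlib's `IsCompact.eventually_forall_of_forall_eventually`). [folklore] -/
theorem exists_eventually_forall_norm_le_of_continuousOn {H : ℝ × P → F} {D : Set P}
    (hH : ContinuousOn H (univ ×ˢ D)) {p₀ : P} (hp₀ : p₀ ∈ D) (a b : ℝ) :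
    ∃ C : ℝ, ∀ᶠ p in 𝓝[D] p₀, ∀ σ ∈ uIcc a b, ‖H (σ, p)‖ ≤ C := by
  have hc₀ : Continuous fun σ : ℝ => H (σ, p₀) :=
    hH.comp_continuous (continuous_id.prodMk continuous_const) fun σ => ⟨mem_univ _, hp₀⟩
  obtain ⟨C₀, hC₀⟩ := (isCompact_uIcc (a := a) (b := b)).exists_bound_of_continuousOn
    hc₀.continuousOn
  refine ⟨C₀ + 1, ?_⟩
  have hP : ∀ σ ∈ uIcc a b, ∀ᶠ z : P × ℝ in 𝓝 (p₀, σ), z.1 ∈ D → ‖H (z.2, z.1)‖ ≤ C₀ + 1 := by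
    intro σ hσ
    have hlt : ‖H (σ, p₀)‖ < C₀ + 1 := lt_of_le_of_lt (hC₀ σ hσ) (lt_add_one _)
    have h1 : ∀ᶠ w in 𝓝[univ ×ˢ D] (σ, p₀), ‖H w‖ < C₀ + 1 :=
      ((hH (σ, p₀) ⟨mem_univ _, hp₀⟩).norm).tendsto.eventually_lt_const hlt
    have h2 : ∀ᶠ w in 𝓝 (σ, p₀), w ∈ univ ×ˢ D → ‖H w‖ < C₀ + 1 :=
      eventually_nhdsWithin_iff.1 h1
    have h3 : ∀ᶠ z : P × ℝ in 𝓝 (p₀, σ), (z.2, z.1) ∈ univ ×ˢ D → ‖H (z.2, z.1)‖ < C₀ + 1 :=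
      (continuous_swap.tendsto (p₀, σ)).eventually h2
    filter_upwards [h3] with z hz hzD
    exact le_of_lt (hz ⟨mem_univ _, hzD⟩)
  have h := (isCompact_uIcc (a := a) (b := b)).eventually_forall_of_forall_eventually
    (P := fun p σ => p ∈ D → ‖H (σ, p)‖ ≤ C₀ + 1) hP
  exact eventually_nhdsWithin_iff.2 (h.mono fun p hp hpD σ hσ => hp σ hσ hpD)

omit [NormedSpace ℝ P] in
/-- **Continuity of parametric integrals within a set.** If `H` is continuous within
`univ ×ˢ D` then `p ↦ ∫ σ in a..b, H (σ, p)` is continuous within `D` (dominated convergence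
with the local uniform bound of `exists_eventually_forall_norm_le_of_continuousOn`; Evans,
App. C). [folklore] -/
theorem continuousOn_parametric_intervalIntegral {H : ℝ × P → F} {D : Set P}
    (hH : ContinuousOn H (univ ×ˢ D)) (a b : ℝ) :
    ContinuousOn (fun p => ∫ σ in a..b, H (σ, p)) D := by
  intro p₀ hp₀
  obtain ⟨C, hC⟩ := exists_eventually_forall_norm_le_of_continuousOn hH hp₀ a b
  have hcont : ∀ p ∈ D, Continuous fun σ : ℝ => H (σ, p) := fun p hp =>
    hH.comp_continuous (continuous_id.prodMk continuous_const) fun σ => ⟨mem_univ _, hp⟩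
  refine intervalIntegral.continuousWithinAt_of_dominated_interval
    (F := fun p σ => H (σ, p)) (bound := fun _ => C) ?_ ?_ ?_ ?_
  · exact eventually_nhdsWithin_of_forall fun p hp => (hcont p hp).aestronglyMeasurable
  · filter_upwards [hC] with p hp
    exact Eventually.of_forall fun σ hσ => hp σ (uIoc_subset_uIcc hσ)
  · exact intervalIntegrable_const
  · refine Eventually.of_forall fun σ _ => ?_
    exact (hH (σ, p₀) ⟨mem_univ _, hp₀⟩).comp
      (continuousWithinAt_const.prodMk continuousWithinAt_id) fun p hp => ⟨mem_univ _, hp⟩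

/-- The partial derivative in the parameter of the within-derivative, `D H (σ, p) ∘ (0, ·)`, is
continuous within `univ ×ˢ D` for `H` of class `C¹` within `univ ×ˢ D`, `D` of unique
differentiability. [folklore] -/
theorem continuousOn_fderivWithin_comp_inr {H : ℝ × P → F} {D : Set P} {n : WithTop ℕ∞}
    (hH : ContDiffOn ℝ n H (univ ×ˢ D)) (hn : n ≠ 0) (hD : UniqueDiffOn ℝ D) :
    ContinuousOn (fun q => (fderivWithin ℝ H (univ ×ˢ D) q).comp (ContinuousLinearMap.inr ℝ ℝ P))
      (univ ×ˢ D) :=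
  ((ContinuousLinearMap.compL ℝ P (ℝ × P) F).flip
    (ContinuousLinearMap.inr ℝ ℝ P)).continuous.comp_continuousOn
    (hH.continuousOn_fderivWithin ((uniqueDiffOn_univ : UniqueDiffOn ℝ (univ : Set ℝ)).prod hD)
      (ENat.one_le_iff_ne_zero_withTop.mpr hn))

/-- **One derivative under the integral sign at interior points of the parameter set.** If `H` is
`C¹` within `univ ×ˢ D` and `D` is a neighbourhood of `p₀`, then `p ↦ ∫ σ in a..b, H (σ, p)` has
derivative `∫ σ in a..b, D H (σ, p₀) ∘ (0, ·)` at `p₀` (Evans, App. C; Mathlib's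
`intervalIntegral.hasFDerivAt_integral_of_dominated_of_fderiv_le`, the dominating constant given by
`exists_eventually_forall_norm_le_of_continuousOn` for the continuous within-derivative). [folklore] -/
theorem hasFDerivAt_parametric_intervalIntegral_of_mem_nhds {H : ℝ × P → F} {D : Set P}
    {n : WithTop ℕ∞} (hH : ContDiffOn ℝ n H (univ ×ˢ D)) (hn : n ≠ 0) (hD : UniqueDiffOn ℝ D)
    {p₀ : P} (hp₀ : D ∈ 𝓝 p₀) (a b : ℝ) :
    HasFDerivAt (fun p => ∫ σ in a..b, H (σ, p))
      (∫ σ in a..b, (fderivWithin ℝ H (univ ×ˢ D) (σ, p₀)).comp (ContinuousLinearMap.inr ℝ ℝ P))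
        p₀ := by
  have hp₀D : p₀ ∈ D := mem_of_mem_nhds hp₀
  -- the derivative integrand and its continuity on `univ ×ˢ D`
  set H₁ : ℝ × P → P →L[ℝ] F :=
    fun q => (fderivWithin ℝ H (univ ×ˢ D) q).comp (ContinuousLinearMap.inr ℝ ℝ P) with hH₁
  have hH₁c : ContinuousOn H₁ (univ ×ˢ D) := continuousOn_fderivWithin_comp_inr hH hn hD
  have hHc : ContinuousOn H (univ ×ˢ D) := hH.continuousOn
  have hcont : ∀ p ∈ D, Continuous fun σ : ℝ => H (σ, p) := fun p hp =>
    hHc.comp_continuous (continuous_id.prodMk continuous_const) fun σ => ⟨mem_univ _, hp⟩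
  have hcont₁ : ∀ p ∈ D, Continuous fun σ : ℝ => H₁ (σ, p) := fun p hp =>
    hH₁c.comp_continuous (continuous_id.prodMk continuous_const) fun σ => ⟨mem_univ _, hp⟩
  -- a uniform bound on the derivative integrand on an open neighbourhood of `p₀` inside `D`
  obtain ⟨C, hC⟩ := exists_eventually_forall_norm_le_of_continuousOn hH₁c hp₀D a b
  rw [nhdsWithin_eq_nhds.2 hp₀] at hC
  have hev₀ : ∀ᶠ p in 𝓝 p₀, p ∈ interior D := interior_mem_nhds.2 hp₀
  have hev : ∀ᶠ p in 𝓝 p₀, p ∈ interior D ∧ ∀ σ ∈ uIcc a b, ‖H₁ (σ, p)‖ ≤ C := hev₀.and hC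
  obtain ⟨s, hs, hsopen, hp₀s⟩ := _root_.eventually_nhds_iff.1 hev
  -- pointwise derivative of the integrand at interior points
  have hderiv : ∀ (σ : ℝ) (p : P), p ∈ interior D →
      HasFDerivAt (fun q : P => H (σ, q)) (H₁ (σ, p)) p := by
    intro σ p hp
    have hUn : univ ×ˢ D ∈ 𝓝 (σ, p) :=
      prod_mem_nhds univ_mem (mem_interior_iff_mem_nhds.1 hp)
    have h1 : HasFDerivAt H (fderivWithin ℝ H (univ ×ˢ D) (σ, p)) (σ, p) := by
      rw [fderivWithin_of_mem_nhds hUn]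
      exact ((hH.contDiffAt hUn).differentiableAt hn).hasFDerivAt
    have h2 : HasFDerivAt (fun q : P => ((σ, q) : ℝ × P)) (ContinuousLinearMap.inr ℝ ℝ P) p :=
      (hasFDerivAt_const σ p).prodMk (hasFDerivAt_id p)
    exact h1.comp p h2
  refine intervalIntegral.hasFDerivAt_integral_of_dominated_of_fderiv_le
    (F := fun p σ => H (σ, p)) (F' := fun p σ => H₁ (σ, p)) (bound := fun _ => C) (μ := volume)
    (hsopen.mem_nhds hp₀s) ?_ ?_ ?_ ?_ ?_ ?_
  · exact Filter.eventually_of_mem hp₀ fun p hp => (hcont p hp).aestronglyMeasurable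
  · exact (hcont p₀ hp₀D).intervalIntegrable _ _
  · exact (hcont₁ p₀ hp₀D).aestronglyMeasurable
  · exact Eventually.of_forall fun σ hσ p hp => (hs p hp).2 σ (uIoc_subset_uIcc hσ)
  · exact intervalIntegrable_const
  · exact Eventually.of_forall fun σ _ p hp => hderiv σ p (hs p hp).1

end General

/-! ### One-sided interval neighbourhoods in a convex time set -/

/-- **Geometry of a non-degenerate interval.** If `S ⊆ ℝ` is convex with non-empty interior and
`t ∈ S`, there is a non-degenerate compact interval `[a, b] ⊆ S` with `(a, b) ⊆ interior S` which
is a neighbourhood of `t` within `S`: a symmetric one around an interior point, `[t, t + r]` at a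
left endpoint, `[t − r, t]` at a right endpoint. [folklore] -/
theorem exists_Ioo_Icc_mem_nhdsWithin_of_convex {S : Set ℝ} (hc : Convex ℝ S)
    (hi : (interior S).Nonempty) {t : ℝ} (ht : t ∈ S) :
    ∃ a b : ℝ, a < b ∧ Ioo a b ⊆ interior S ∧ Icc a b ⊆ S ∧ Icc a b ∈ 𝓝[S] t := by
  by_cases hti : t ∈ interior S
  · obtain ⟨ε, hε, hball⟩ := Metric.isOpen_iff.1 isOpen_interior t hti
    have hIcc : Icc (t - ε / 2) (t + ε / 2) ⊆ interior S := by
      intro y hy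
      apply hball
      rw [Real.ball_eq_Ioo]
      exact ⟨by linarith [hy.1], by linarith [hy.2]⟩
    exact ⟨t - ε / 2, t + ε / 2, by linarith, Ioo_subset_Icc_self.trans hIcc,
      hIcc.trans interior_subset,
      mem_nhdsWithin_of_mem_nhds (Icc_mem_nhds (by linarith) (by linarith))⟩
  · obtain ⟨c, hc'⟩ := hi
    have hcS : c ∈ S := interior_subset hc'
    have hord : S.OrdConnected := hc.ordConnected
    rcases lt_trichotomy t c with htc | rfl | hct
    · -- `t` is the left endpoint of `S`
      have hIcc : Icc t c ⊆ S := hord.out ht hcS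
      have hIoo : Ioo t c ⊆ interior S :=
        isOpen_Ioo.subset_interior_iff.2 (Ioo_subset_Icc_self.trans hIcc)
      have hleft : ∀ y ∈ S, t ≤ y := by
        intro y hy
        by_contra! hyt
        exact hti (isOpen_Ioo.subset_interior_iff.2
          (Ioo_subset_Icc_self.trans (hord.out hy hcS)) ⟨hyt, htc⟩)
      refine ⟨t, c, htc, hIoo, hIcc, ?_⟩
      exact mem_of_superset (inter_mem_nhdsWithin S (Iio_mem_nhds htc))
        fun y hy => ⟨hleft y hy.1, le_of_lt hy.2⟩
    · exact absurd hc' hti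
    · -- `t` is the right endpoint of `S`
      have hIcc : Icc c t ⊆ S := hord.out hcS ht
      have hIoo : Ioo c t ⊆ interior S :=
        isOpen_Ioo.subset_interior_iff.2 (Ioo_subset_Icc_self.trans hIcc)
      have hright : ∀ y ∈ S, y ≤ t := by
        intro y hy
        by_contra! hyt
        exact hti (isOpen_Ioo.subset_interior_iff.2
          (Ioo_subset_Icc_self.trans (hord.out hcS hy)) ⟨hct, hyt⟩)
      refine ⟨c, t, hct, hIoo, hIcc, ?_⟩
      exact mem_of_superset (inter_mem_nhdsWithin S (Ioi_mem_nhds hct))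
        fun y hy => ⟨le_of_lt hy.2, hright y hy.1⟩

/-- A convex set of unique differentiability in `ℝ` containing a point has non-empty interior
(a point of unique differentiability is an accumulation point, Mathlib's
`UniqueDiffWithinAt.accPt`; a convex subset of `ℝ` with two points contains the open interval
between them). [folklore] -/
theorem interior_nonempty_of_convex_of_uniqueDiffWithinAt {S : Set ℝ} (hc : Convex ℝ S) {t : ℝ}
    (ht : t ∈ S) (hu : UniqueDiffWithinAt ℝ S t) : (interior S).Nonempty := by
  obtain ⟨y, hy, hyt⟩ := accPt_iff_nhds.1 hu.accPt univ univ_mem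
  have hyS : y ∈ S := hy.2
  have hord : S.OrdConnected := hc.ordConnected
  rcases lt_or_gt_of_ne hyt with h | h
  · refine ⟨(y + t) / 2, isOpen_Ioo.subset_interior_iff.2
      (Ioo_subset_Icc_self.trans (hord.out hyS ht)) ?_⟩
    exact ⟨by linarith, by linarith⟩
  · refine ⟨(t + y) / 2, isOpen_Ioo.subset_interior_iff.2
      (Ioo_subset_Icc_self.trans (hord.out ht hyS)) ?_⟩
    exact ⟨by linarith, by linarith⟩

/-- A convex time set of unique differentiability lies in the closure of its interior (it is
empty or a non-degenerate interval; Mathlib's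
`Convex.closure_interior_eq_closure_of_nonempty_interior`). This is the hypothesis under which
the tree exchanges the one-sided time derivative with spatial derivatives
(`IsSmoothSpaceTimeOn.timeDerivWithin_fderiv_slice_apply`, `IsSmoothSpaceTimeOn.curl_timeDerivWithin`). [folklore] -/
theorem subset_closure_interior_of_convex_of_uniqueDiffOn {S : Set ℝ} (hc : Convex ℝ S)
    (hS : UniqueDiffOn ℝ S) : S ⊆ closure (interior S) := by
  intro t ht
  have hi : (interior S).Nonempty :=
    interior_nonempty_of_convex_of_uniqueDiffWithinAt hc ht (hS t ht)
  rw [hc.closure_interior_eq_closure_of_nonempty_interior hi]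
  exact subset_closure ht

/-! ### Parametric integrals within `S ×ˢ univ`, `S` a convex time set -/

section Prod

variable {X : Type*} [NormedAddCommGroup X] [NormedSpace ℝ X]
variable {F : Type*} [NormedAddCommGroup F] [NormedSpace ℝ F]

/-- **One derivative under the integral sign, up to the boundary of the time set.** Let `S ⊆ ℝ`
be convex with non-empty interior and let `H : ℝ × (ℝ × X) → F` be `C¹` within
`univ ×ˢ (S ×ˢ univ)`. Then at every `p ∈ S ×ˢ univ` the parametric integral
`p ↦ ∫ σ in a..b, H (σ, p)` has, within `S ×ˢ univ`, the derivative
`∫ σ in a..b, D H (σ, p) ∘ (0, ·)` (`D` the within-derivative). At interior times this is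
`hasFDerivAt_parametric_intervalIntegral_of_mem_nhds`; at an endpoint `t₀` of `S` it follows on
the slab `(t₀, t₀ ± r) × X` from Mathlib's `hasFDerivWithinAt_closure_of_tendsto_fderiv`, the
parametric integral and the candidate derivative being continuous within `S ×ˢ univ`
(`continuousOn_parametric_intervalIntegral`). [folklore] -/
theorem hasFDerivWithinAt_parametric_intervalIntegral_prod {S : Set ℝ} (hc : Convex ℝ S)
    (hi : (interior S).Nonempty) {H : ℝ × (ℝ × X) → F} {n : WithTop ℕ∞}
    (hH : ContDiffOn ℝ n H (univ ×ˢ (S ×ˢ univ))) (hn : n ≠ 0) (a b : ℝ) {p : ℝ × X}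
    (hp : p ∈ S ×ˢ (univ : Set X)) :
    HasFDerivWithinAt (fun p => ∫ σ in a..b, H (σ, p))
      (∫ σ in a..b, (fderivWithin ℝ H (univ ×ˢ (S ×ˢ univ)) (σ, p)).comp
        (ContinuousLinearMap.inr ℝ ℝ (ℝ × X))) (S ×ˢ univ) p := by
  obtain ⟨t₀, x₀⟩ := p
  have hSU : UniqueDiffOn ℝ S := uniqueDiffOn_convex hc hi
  have hD : UniqueDiffOn ℝ (S ×ˢ (univ : Set X)) := hSU.prod uniqueDiffOn_univ
  set Pf : ℝ × X → F := fun p => ∫ σ in a..b, H (σ, p) with hPf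
  set H₁ : ℝ × (ℝ × X) → (ℝ × X) →L[ℝ] F := fun q =>
    (fderivWithin ℝ H (univ ×ˢ (S ×ˢ univ)) q).comp (ContinuousLinearMap.inr ℝ ℝ (ℝ × X)) with hH₁
  set P₁ : ℝ × X → (ℝ × X) →L[ℝ] F := fun p => ∫ σ in a..b, H₁ (σ, p) with hP₁
  -- continuity of `Pf` and `P₁` within `S ×ˢ univ`
  have hH₁c : ContinuousOn H₁ (univ ×ˢ (S ×ˢ univ)) := continuousOn_fderivWithin_comp_inr hH hn hD
  have hPc : ContinuousOn Pf (S ×ˢ univ) :=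
    continuousOn_parametric_intervalIntegral hH.continuousOn a b
  have hP₁c : ContinuousOn P₁ (S ×ˢ univ) := continuousOn_parametric_intervalIntegral hH₁c a b
  -- the Leibniz rule at interior times
  have hint : ∀ q : ℝ × X, q.1 ∈ interior S → HasFDerivAt Pf (P₁ q) q := fun q hq =>
    hasFDerivAt_parametric_intervalIntegral_of_mem_nhds hH hn hD
      (prod_mem_nhds (mem_interior_iff_mem_nhds.1 hq) univ_mem) a b
  -- a one-sided interval neighbourhood of `t₀` in `S`
  obtain ⟨a', b', hab, hIoo, hIcc, hnhds⟩ := exists_Ioo_Icc_mem_nhdsWithin_of_convex hc hi hp.1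
  set s : Set (ℝ × X) := Ioo a' b' ×ˢ univ with hs
  have hsD : s ⊆ S ×ˢ univ := prod_mono (hIoo.trans interior_subset) Subset.rfl
  have hcl : closure s = Icc a' b' ×ˢ univ := by
    rw [hs, closure_prod_eq, closure_Ioo hab.ne, closure_univ]
  have hclD : closure s ⊆ S ×ˢ univ := by
    rw [hcl]; exact prod_mono hIcc Subset.rfl
  have h1 : HasFDerivWithinAt Pf (P₁ (t₀, x₀)) (closure s) (t₀, x₀) := by
    refine hasFDerivWithinAt_closure_of_tendsto_fderiv ?_ ((convex_Ioo a' b').prod convex_univ)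
      (isOpen_Ioo.prod isOpen_univ) ?_ ?_
    · intro q hq
      exact (hint q (hIoo hq.1)).differentiableAt.differentiableWithinAt
    · intro y hy
      exact (hPc y (hclD hy)).mono hsD
    · have e : (fun y => fderiv ℝ Pf y) =ᶠ[𝓝[s] (t₀, x₀)] P₁ :=
        eventually_nhdsWithin_of_forall fun y hy => (hint y (hIoo hy.1)).fderiv
      exact (((hP₁c (t₀, x₀) hp).mono hsD).tendsto).congr' e.symm
  refine h1.mono_of_mem_nhdsWithin ?_
  rw [hcl, nhdsWithin_prod_eq, nhdsWithin_univ]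
  exact prod_mem_prod hnhds univ_mem

variable [FiniteDimensional ℝ X]

/-- `C^n` regularity within `S ×ˢ univ` of parametric integrals of integrands smooth within
`univ ×ˢ (S ×ˢ univ)`, every `n : ℕ`, `S` convex with non-empty interior (induction on `n` over
all such integrands at once: by `hasFDerivWithinAt_parametric_intervalIntegral_prod` each
directional within-derivative is the parametric integral of the smooth integrand
`(σ, p) ↦ D H (σ, p) (0, v)`). [folklore] -/
theorem contDiffOn_nat_parametric_intervalIntegral_prod {S : Set ℝ} (hc : Convex ℝ S)
    (hi : (interior S).Nonempty) (a b : ℝ) :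
    ∀ (n : ℕ) {H : ℝ × (ℝ × X) → F}, ContDiffOn ℝ ∞ H (univ ×ˢ (S ×ˢ univ)) →
      ContDiffOn ℝ n (fun p => ∫ σ in a..b, H (σ, p)) (S ×ˢ (univ : Set X))
  | 0, H, hH => by
    rw [Nat.cast_zero, contDiffOn_zero]
    exact continuousOn_parametric_intervalIntegral hH.continuousOn a b
  | n + 1, H, hH => by
    have hSU : UniqueDiffOn ℝ S := uniqueDiffOn_convex hc hi
    have hD : UniqueDiffOn ℝ (S ×ˢ (univ : Set X)) := hSU.prod uniqueDiffOn_univ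
    have hU : UniqueDiffOn ℝ (univ ×ˢ (S ×ˢ (univ : Set X))) :=
      (uniqueDiffOn_univ : UniqueDiffOn ℝ (univ : Set ℝ)).prod hD
    have htop : (∞ : WithTop ℕ∞) ≠ 0 := by simp
    rw [Nat.cast_succ, contDiffOn_succ_iff_fderiv_apply hD]
    refine ⟨fun p hp => (hasFDerivWithinAt_parametric_intervalIntegral_prod hc hi hH htop a b
      hp).differentiableWithinAt, fun h => ?_, fun v => ?_⟩
    · exact absurd h (by exact_mod_cast WithTop.coe_ne_top)
    · -- the directional within-derivative is again a parametric integral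
      have hH₁c := continuousOn_fderivWithin_comp_inr hH htop hD
      have hv : ∀ p ∈ S ×ˢ (univ : Set X),
          fderivWithin ℝ (fun p => ∫ σ in a..b, H (σ, p)) (S ×ˢ univ) p v =
            ∫ σ in a..b, fderivWithin ℝ H (univ ×ˢ (S ×ˢ univ)) (σ, p) ((0 : ℝ), v) := by
        intro p hp
        have hint : IntervalIntegrable (fun σ : ℝ =>
            (fderivWithin ℝ H (univ ×ˢ (S ×ˢ univ)) (σ, p)).comp
              (ContinuousLinearMap.inr ℝ ℝ (ℝ × X))) volume a b :=
          (hH₁c.comp_continuous (continuous_id.prodMk continuous_const)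
            fun σ => ⟨mem_univ _, hp⟩).intervalIntegrable _ _
        rw [(hasFDerivWithinAt_parametric_intervalIntegral_prod hc hi hH htop a b hp).fderivWithin
          (hD p hp), ContinuousLinearMap.intervalIntegral_apply hint]
        rfl
      refine (contDiffOn_nat_parametric_intervalIntegral_prod hc hi a b n
        (H := fun q => fderivWithin ℝ H (univ ×ˢ (S ×ˢ univ)) q ((0 : ℝ), v)) ?_).congr hv
      exact (hH.fderivWithin hU (m := ∞) le_rfl).clm_apply contDiffOn_const

/-- **Smooth dependence on parameters up to the boundary of the time set.** If `S ⊆ ℝ` is convex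
with non-empty interior and `H : ℝ × (ℝ × X) → F` is `C^∞` within `univ ×ˢ (S ×ˢ univ)`
(`X` finite dimensional), then `p ↦ ∫ σ in a..b, H (σ, p)` is `C^∞` within
`S ×ˢ univ` (Evans, App. C; Hörmander, Thm. 1.1.9, here including the one-sided derivatives at
the endpoints of `S`). [folklore] -/
theorem contDiffOn_parametric_intervalIntegral_prod {S : Set ℝ} (hc : Convex ℝ S)
    (hi : (interior S).Nonempty) {H : ℝ × (ℝ × X) → F}
    (hH : ContDiffOn ℝ ∞ H (univ ×ˢ (S ×ˢ univ))) (a b : ℝ) :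
    ContDiffOn ℝ ∞ (fun p => ∫ σ in a..b, H (σ, p)) (S ×ˢ (univ : Set X)) :=
  contDiffOn_infty.2 fun n => contDiffOn_nat_parametric_intervalIntegral_prod hc hi a b n hH

end Prod

/-! ### The segment potential of a field jointly smooth on `S × E`, `S` an interval -/

section Segment

variable {E : Type*} [NormedAddCommGroup E] [InnerProductSpace ℝ E] [FiniteDimensional ℝ E]

/-- **Joint smoothness of the segment potential, up to the boundary of the time set.** If `G` is
jointly smooth on `S × E` (`IsSmoothSpaceTimeOn S G`) for a convex time set `S` of unique
differentiability — i.e. any non-degenerate interval, endpoints included or not — then so is the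
segment (Poincaré) potential `(t, x) ↦ ∫₀¹ ⟪G(t, σ x), x⟫ dσ`. The open-`S` case is
`IsSmoothSpaceTimeOn.segmentIntegral` (`PressureReconstruction`); here the one-sided time
derivatives at the endpoints are included (`contDiffOn_parametric_intervalIntegral_prod`). [folklore] -/
theorem IsSmoothSpaceTimeOn.segmentIntegral_of_convex {S : Set ℝ} (hc : Convex ℝ S)
    (hS : UniqueDiffOn ℝ S) {G : ℝ → E → E} (hG : IsSmoothSpaceTimeOn S G) :
    IsSmoothSpaceTimeOn S (fun t x => ∫ σ in (0 : ℝ)..1, ⟪G t (σ • x), x⟫) := by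
  intro z hz
  have hi : (interior S).Nonempty :=
    interior_nonempty_of_convex_of_uniqueDiffWithinAt hc hz.1 (hS z.1 hz.1)
  -- the integrand, smooth within `univ ×ˢ (S ×ˢ univ)`
  set H : ℝ × (ℝ × E) → ℝ := fun r => ⟪G r.2.1 (r.1 • r.2.2), r.2.2⟫ with hH
  have hA : ContDiff ℝ ∞ fun r : ℝ × (ℝ × E) => ((r.2.1, r.1 • r.2.2) : ℝ × E) :=
    (contDiff_fst.comp contDiff_snd).prodMk (contDiff_fst.smul (contDiff_snd.comp contDiff_snd))
  have hGA : ContDiffOn ℝ ∞ (uncurry G ∘ fun r : ℝ × (ℝ × E) => ((r.2.1, r.1 • r.2.2) : ℝ × E))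
      (univ ×ˢ (S ×ˢ univ)) :=
    hG.comp hA.contDiffOn fun r hr => ⟨hr.2.1, mem_univ _⟩
  have hHs : ContDiffOn ℝ ∞ H (univ ×ˢ (S ×ˢ univ)) :=
    hGA.inner ℝ (contDiff_snd.comp contDiff_snd).contDiffOn
  exact contDiffOn_parametric_intervalIntegral_prod hc hi hHs 0 1 z hz

end Segment

end Literature.Analysis.FluidPDE

end
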